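import Summits.Ventures.PercRepro.RankLevelSetCoreSevenOfFormS345
import Summits.Ventures.PercRepro.S2TelescopeCount
import Summits.Ventures.PercRepro.RankLevelSetTelForm2
import Summits.Ventures.PercRepro.RankLevelSetNullitySplit

/-!
# PercRepro — THE `e`-FREE CORE AT LEVEL `7` FROM A NUMERIC FORM, ON THE TELESCOPING COUNT WITH THE NULLITY SPLIT
(p8, gen 21; a feeder for S4 — the top of the `q = 7` window, the rows `52` and below)

`c025_core_seven_of_form_split` — `c025_core_seven_of_form_telcap` (RankLevelSetCoreSevenOfFormTelCap) with the `N`-side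
chosen per cell between TWO counts, by THE NULLITY SPLIT (RankLevelSetTelForm2):
* **case B** — some set `X` of rank `≤ 7` carries the whole nullity, `|X| = r(X) + d`: then every `y ∉ X` is a coloop,
  every spanning `A` contains `E ∖ X`, and `#U(p, 7) ≤ #𝒫(X) = 2^{|X|} ≤ 2^{7 + d}` (`topCount_le_two_pow_of_full`,
  RankLevelSetNullitySplit); `d ≤ 72` here (`|X| ≤ 79`),
  so `2^{7 + d}` sits under the powerset term of `nsideTel` and under the explicit `+ 2^{7 + d}` of the split form;
* **case A** — every set of rank `≤ 7` has `≤ r(X) + d − 1` points: the telescoping count runs with the caps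
  `f = min 79 (6 + d)`, `f' = min 39 (5 + d)`, whose `N`-side is `nsideTel2` (the closure cap `F` one smaller, the powerset
  term `2^{min 79 (6 + d)}`); the count with the old caps (`nsideTel`) holds as well.
The form hypothesis is therefore a DISJUNCTION — `c₁·nsideTel ≤ c₂·2^{d−7}·C(p+7, 7)` (the g20/g21 form) OR
`c₁·(nsideTel2 + 2^{7+d}) ≤ c₂·2^{d−7}·C(p+7, 7)` (the split form) — and the nullity-capped `Y`-tail of the telcap core.
Priced exactly (work/tools/price_split.py): at `(55, 13)` the split form is `0.667` of the budget against `0.888`; with the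
bootstrapped triangle count and p1's T4⁺ every cell of the rows `52 … 48` closes (the cells near `D₀` on the old form).
Axioms: standard.
-/

set_option exponentiation.threshold 1024

open scoped Matroid

namespace PercRepro

namespace ThmN

open Set

variable {α : Type}

/-- **The `e`-free core at level `7` from a numeric form ON THE TELESCOPING COUNT WITH THE NULLITY SPLIT, the `3`-, `4`-
and `5`-circuit bounds as parameters**: the form `(c₁, c₂)` of the cell `(p, d)` is EITHER the `N`-side
`c₁·nsideTel p d S3 S4 S5 ≤ c₂·2^{d−7}·C(p+7, 7)` OR the split `N`-side `c₁·(nsideTel2 p d S3 S4 S5 + 2^{7+d}) ≤ c₂·2^{d−7}·C(p+7, 7)`,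
together with the nullity-capped `Y`-tail, taken as a HYPOTHESIS; the telescoping count (with the caps of case A, or the old
ones), the coloop case B, `f(7) ≤ 79`, `f(6) ≤ 39`, the giant flat by its powerset and the non-coloop bound of the `e`-free
core (`S2.ncard_eRk_eq_ncard_le_le_tel`, `S2.card_nonColoops_ge_of_flat_bounds`). -/
theorem c025_core_seven_of_form_split (M : Matroid α) [M.Finite] (p d S3 S4 S5 : ℕ) (hd8 : 8 ≤ d)
    (hR : M.eRank = (p : ℕ∞)) (hn : M.E.ncard = p + d)
    (hfree : ∀ e ∈ M.E, ∃ A ⊆ M.E \ {e}, e ∉ M.closure A ∧ e ∉ M.closure ((M.E \ {e}) \ A))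
    (hs3 : {C | M.IsCircuit C ∧ C.ncard = 3}.ncard ≤ S3)
    (hs4 : {C | M.IsCircuit C ∧ C.ncard = 4}.ncard ≤ S4)
    (hs5 : {C | M.IsCircuit C ∧ C.ncard = 5}.ncard ≤ S5)
    (hform :
      ∃ c₁ c₂ : ℕ, 0 < c₂ ∧ c₂ < c₁ ∧
      (((c₁ : ℕ) : ℚ) * nsideTel p d S3 S4 S5 ≤ ((c₂ : ℕ) : ℚ) * 2 ^ (d - 7) * (((p + 7).choose 7 : ℕ) : ℚ) ∨
        ((c₁ : ℕ) : ℚ) * (nsideTel2 p d S3 S4 S5 + 2 ^ (7 + d)) ≤ ((c₂ : ℕ) : ℚ) * 2 ^ (d - 7) * (((p + 7).choose 7 : ℕ) : ℚ)) ∧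
        c₁ * ((p + d).choose 7 * 2 ^ (min 72 d) + (p + d).choose 6 * 2 ^ (min 33 d) + (p + d).choose 5 * 2 ^ (min 14 d) + (p + d).choose 4 * 2 ^ 6 + (p + d).choose 3 * 2 ^ 3 + (p + d).choose 2 * 2 + (p + d) + 1 + ∑ j ∈ Finset.range (d + 1), (p + d).choose j) ≤ (c₁ - c₂) * 2 ^ (p + d)) :
    RLS M p 7 := by
  classical
  have hEcard : M.ground_finite.toFinset.card = p + d := by
    rw [← Set.ncard_eq_toFinset_card _ M.ground_finite]; exact hn
  -- the core is simple: every circuit has `≥ 3` elements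
  have hL0 : ∀ e ∈ M.E, ¬ M.IsLoop e := not_isLoop_of_free M hfree
  have hs : ∀ e ∈ M.E, ∀ f ∈ M.E, e ≠ f → M.eRk {e, f} = 2 := by
    intro e he f hf hef
    have h2 : (2 : ℕ∞) ≤ M.eRk {e, f} :=
      two_le_eRk_of_two_le_ncard_of_free M hfree (pair_subset he hf) (by rw [ncard_pair hef])
    have h3 : M.eRk {e, f} ≤ 2 := by
      have := M.eRk_le_encard {e, f}
      rwa [encard_pair hef] at this
    exact le_antisymm h3 h2
  have hcirc : ∀ C, M.IsCircuit C → 3 ≤ C.encard := three_le_encard_of_circuit M hL0 hs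
  have hd : M.E.encard = M.eRank + d := by
    rw [hR, ← M.ground_finite.cast_ncard_eq, hn]
    push_cast
    ring
  -- the nullity cap: every `X ⊆ E` has `|X| ≤ r(X) + d`
  have hcap : ∀ X ⊆ M.E, ∀ k : ℕ, M.eRk X ≤ k → X.ncard ≤ k + d := by
    intro X hX k hr
    have h1 := Matroid.encard_le_eRk_add_of_encard_eq hX hd
    have h2 : X.encard ≤ (k : ℕ∞) + d := h1.trans (by gcongr)
    have hfin : X.Finite := M.ground_finite.subset hX
    rw [← hfin.cast_ncard_eq] at h2
    exact_mod_cast h2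
  -- rank-`≤ 7` sets have `≤ min 79 (7 + d)` points, rank-`≤ 6` sets `≤ min 39 (6 + d)`
  have hflat : ∀ X ⊆ M.E, M.eRk X ≤ 7 → X.ncard ≤ min 79 (7 + d) :=
    fun X hX hr => le_min (ncard_le_seventynine_of_eRk_le_seven_of_free M hfree X hX hr) (hcap X hX 7 hr)
  have hflat' : ∀ X ⊆ M.E, M.eRk X ≤ ((7 - 1 : ℕ) : ℕ∞) → X.ncard ≤ min 39 (6 + d) :=
    fun X hX hr => le_min (ncard_le_thirtynine_of_eRk_le_six_of_free M hfree hX (by simpa using hr))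
      (hcap X hX 6 (by simpa using hr))
  have hinter := hinter_seven M hd hfree
  -- the flat bounds of the `e`-free core at every rank `≤ 6`
  have hC1 : ∀ L ⊆ M.E, M.eRk L = 2 → L.ncard ≤ 3 :=
    fun L hL hr => ncard_le_three_of_eRk_two M hs hfree hL hr
  have hC2 : ∀ P ⊆ M.E, M.eRk P ≤ 3 → P.ncard ≤ 6 :=
    fun P hP hr => ncard_le_six_of_eRk_le_three_of_free M hfree hP hr
  have hf0 : ∀ X ⊆ M.E, M.eRk X ≤ 0 → X.ncard ≤ 0 := fun X hX hr => by
    have := ncard_add_one_le_two_pow_of_eRk_le M hL0 hfree 0 X hX (by exact_mod_cast hr)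
    omega
  have hf1 : ∀ X ⊆ M.E, M.eRk X ≤ 1 → X.ncard ≤ 1 := fun X hX hr => by
    have := ncard_add_one_le_two_pow_of_eRk_le M hL0 hfree 1 X hX (by exact_mod_cast hr)
    omega
  have hf2 : ∀ X ⊆ M.E, M.eRk X ≤ 2 → X.ncard ≤ 3 := fun X hX hr => by
    have := ncard_add_one_le_two_pow_of_eRk_le M hL0 hfree 2 X hX (by exact_mod_cast hr)
    omega
  have hf4 : ∀ X ⊆ M.E, M.eRk X ≤ 4 → X.ncard ≤ 10 :=
    fun X hX hr => ncard_le_ten_of_eRk_le_four_of_free M hfree hX hr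
  have hf5 : ∀ X ⊆ M.E, M.eRk X ≤ 5 → X.ncard ≤ 19 :=
    fun X hX hr => ncard_le_nineteen_of_eRk_le_five_of_free M hfree hX hr
  have hf6 : ∀ X ⊆ M.E, M.eRk X ≤ 6 → X.ncard ≤ 39 :=
    fun X hX hr => ncard_le_thirtynine_of_eRk_le_six_of_free M hfree hX hr
  -- the non-coloop bound on every level set
  have hcol : ∀ m, 7 + 1 ≤ m → m ≤ d → ∀ B ∈ Matroid.levelF M 7 m,
      (fun ν => ν + S2.rminF ν) (m - 7) ≤ (S2.nonColoops M 7 B).card := by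
    intro m hm _ B hB
    rw [Matroid.levelF, Finset.mem_filter, Finset.mem_powersetCard] at hB
    obtain ⟨⟨hBsub, hBcard⟩, hBr⟩ := hB
    have hBE : (B : Set α) ⊆ M.E := by
      rw [← Matroid.coe_groundF M]; exact_mod_cast hBsub
    have := S2.card_nonColoops_ge_of_flat_bounds (M := M) B hBE (by exact_mod_cast hBr) (by omega)
      hf0 hf1 hf2 hC2 hf4 hf5 hf6
    rw [hBcard] at this
    exact this
  have hρ : ∀ ν, 1 ≤ (fun ν => ν + S2.rminF ν) (ν + 1) := fun ν => by
    have := S2.one_le_rminF (ν + 1)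
    simp only
    omega
  -- the circuit counts beyond `5`: the nullity bounds
  have hs6 : {C | M.IsCircuit C ∧ C.ncard = 6}.ncard ≤ (d + 5).choose 6 :=
    Matroid.ncard_circuits_le_choose_of_encard M hd 5
  have hs7 : {C | M.IsCircuit C ∧ C.ncard = 7}.ncard ≤ (d + 6).choose 7 :=
    Matroid.ncard_circuits_le_choose_of_encard M hd 6
  have hs8 : {C | M.IsCircuit C ∧ C.ncard = 8}.ncard ≤ (d + 7).choose 8 :=
    Matroid.ncard_circuits_le_choose_of_encard M hd 7
  -- (U): the telescoping count, in `ℚ`, then the circuit bounds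
  have hU0 := S2.ncard_eRk_eq_ncard_le_le_tel M 7 (min 79 (7 + d)) (min 39 (6 + d))
    (max ((d + min 33 d) / 2 + 1) (min 32 (d - 1) + 2)) (min 33 d) (fun ν => ν + S2.rminF ν)
    (by norm_num) hcirc hC1 hC2 hflat hflat' hinter hd (by omega) (by omega) hρ hcol
  have hU1 := Matroid.topCount_le_ncard_compl (M := M) hR hd 7
  have hm1 : min (min 79 (7 + d) - (7 + 1)) (max ((d + min 33 d) / 2 + 1) (min 32 (d - 1) + 2) - 2) =
      min 71 (max ((d + min 33 d) / 2 + 1) (min 32 (d - 1) + 2) - 2) := by omega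
  have hm3 : min (min 79 (7 + d)) (7 + d) = min 79 (7 + d) := by omega
  rw [hn, sum_Icc_three_eight_q, hm1, hm3] at hU0
  simp only [show (7 : ℕ) + 1 = 8 from rfl, show (8 : ℕ) - 3 = 5 from rfl, show (8 : ℕ) - 4 = 4 from rfl,
    show (8 : ℕ) - 5 = 3 from rfl, show (8 : ℕ) - 6 = 2 from rfl, show (8 : ℕ) - 7 = 1 from rfl,
    show (8 : ℕ) - 8 = 0 from rfl, Nat.choose_one_right, Nat.choose_zero_right] at hU0
  have hUq : (Matroid.topCount M p 7 : ℚ) ≤ nsideTel p d S3 S4 S5 := by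
    have hU1q : (Matroid.topCount M p 7 : ℚ) ≤
        ({B : Set α | B ⊆ M.E ∧ M.eRk B = 7 ∧ B.ncard ≤ d}.ncard : ℚ) := by exact_mod_cast hU1
    have hsm : {C | M.IsCircuit C ∧ C.ncard = 3}.ncard * (p + d - 3).choose 5 +
        {C | M.IsCircuit C ∧ C.ncard = 4}.ncard * (p + d - 4).choose 4 +
        {C | M.IsCircuit C ∧ C.ncard = 5}.ncard * (p + d - 5).choose 3 +
        {C | M.IsCircuit C ∧ C.ncard = 6}.ncard * (p + d - 6).choose 2 +
        {C | M.IsCircuit C ∧ C.ncard = 7}.ncard * (p + d - 7) + {C | M.IsCircuit C ∧ C.ncard = 8}.ncard * 1 ≤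
        S3 * (p + d - 3).choose 5 + S4 * (p + d - 4).choose 4 +
          S5 * (p + d - 5).choose 3 + (d + 5).choose 6 * (p + d - 6).choose 2 +
          (d + 6).choose 7 * (p + d - 7) + (d + 7).choose 8 := by
      have := hs8
      gcongr
      omega
    have hsmq : (({C | M.IsCircuit C ∧ C.ncard = 3}.ncard : ℚ) * ((p + d - 3).choose 5 : ℚ) +
        ({C | M.IsCircuit C ∧ C.ncard = 4}.ncard : ℚ) * ((p + d - 4).choose 4 : ℚ) +
        ({C | M.IsCircuit C ∧ C.ncard = 5}.ncard : ℚ) * ((p + d - 5).choose 3 : ℚ) +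
        ({C | M.IsCircuit C ∧ C.ncard = 6}.ncard : ℚ) * ((p + d - 6).choose 2 : ℚ) +
        ({C | M.IsCircuit C ∧ C.ncard = 7}.ncard : ℚ) * ((p + d - 7 : ℕ) : ℚ) +
        ({C | M.IsCircuit C ∧ C.ncard = 8}.ncard : ℚ) * ((1 : ℕ) : ℚ)) ≤
        ((S3 * (p + d - 3).choose 5 + S4 * (p + d - 4).choose 4 +
          S5 * (p + d - 5).choose 3 + (d + 5).choose 6 * (p + d - 6).choose 2 +
          (d + 6).choose 7 * (p + d - 7) + (d + 7).choose 8 : ℕ) : ℚ) := by exact_mod_cast hsm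
    refine hU1q.trans (hU0.trans ?_)
    unfold nsideTel
    refine add_le_add (add_le_add le_rfl (Finset.sum_le_sum (fun j _ => ?_))) le_rfl
    apply S2.lamTel_mono
    push_cast at hsmq ⊢
    linarith
  -- (Y): the rank-`≤ 7` sets through their closures; the spanning sets by the `5/2` tail
  have hY := Matroid.two_pow_le_midCount_add (M := M) p 7 hR
  have hsum7 := S2.ncard_eRk_le_le_sum M 7
  simp only [Finset.sum_range_succ, Finset.sum_range_zero, zero_add] at hsum7
  have hB := Matroid.ncard_spanning_le (M := M) hd
  rw [hEcard] at hY hB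
  obtain ⟨c₁, c₂, hc₂, hc₁₂, hpolyq, hT⟩ := hform
  have hAB : c₁ * ({X : Set α | X ⊆ M.E ∧ M.eRk X ≤ 7}.ncard +
      {X : Set α | X ⊆ M.E ∧ M.eRk X = M.eRank}.ncard) ≤ (c₁ - c₂) * 2 ^ (p + d) := by
    have h7 : {X : Set α | X ⊆ M.E ∧ M.eRk X = (7 : ℕ)}.ncard ≤ M.E.ncard.choose 7 * 2 ^ (min 72 d) := by
      have := S2.ncard_eRk_eq_le_choose_mul_two_pow M 7 (min 79 (7 + d))
        (fun X hX hr => hflat X hX (by exact_mod_cast hr))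
      rwa [show min 79 (7 + d) - 7 = min 72 d by omega] at this
    have h6 : {X : Set α | X ⊆ M.E ∧ M.eRk X = (6 : ℕ)}.ncard ≤ M.E.ncard.choose 6 * 2 ^ (min 33 d) := by
      have := S2.ncard_eRk_eq_le_choose_mul_two_pow M 6 (min 39 (6 + d))
        (fun X hX hr => le_min (ncard_le_thirtynine_of_eRk_le_six_of_free M hfree hX (by exact_mod_cast hr))
          (hcap X hX 6 (by exact_mod_cast hr)))
      rwa [show min 39 (6 + d) - 6 = min 33 d by omega] at this
    have h5 : {X : Set α | X ⊆ M.E ∧ M.eRk X = (5 : ℕ)}.ncard ≤ M.E.ncard.choose 5 * 2 ^ (min 14 d) := by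
      have := S2.ncard_eRk_eq_le_choose_mul_two_pow M 5 (min 19 (5 + d))
        (fun X hX hr => le_min (ncard_le_nineteen_of_eRk_le_five_of_free M hfree hX (by exact_mod_cast hr))
          (hcap X hX 5 (by exact_mod_cast hr)))
      rwa [show min 19 (5 + d) - 5 = min 14 d by omega] at this
    have h4 : {X : Set α | X ⊆ M.E ∧ M.eRk X = (4 : ℕ)}.ncard ≤ M.E.ncard.choose 4 * 2 ^ (10 - 4) :=
      S2.ncard_eRk_eq_le_choose_mul_two_pow M 4 10
        (fun X hX hr => ncard_le_ten_of_eRk_le_four_of_free M hfree hX (by exact_mod_cast hr))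
    have h3 : {X : Set α | X ⊆ M.E ∧ M.eRk X = (3 : ℕ)}.ncard ≤ M.E.ncard.choose 3 * 2 ^ (6 - 3) :=
      S2.ncard_eRk_eq_le_choose_mul_two_pow M 3 6
        (fun X hX hr => ncard_le_six_of_eRk_le_three_of_free M hfree hX (by exact_mod_cast hr))
    have h2 : {X : Set α | X ⊆ M.E ∧ M.eRk X = (2 : ℕ)}.ncard ≤ M.E.ncard.choose 2 * 2 ^ (3 - 2) :=
      S2.ncard_eRk_eq_le_choose_mul_two_pow M 2 3
        (fun X hX hr => by
          have := ncard_add_one_le_two_pow_of_eRk_le M hL0 hfree 2 X hX hr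
          omega)
    have h1 : {X : Set α | X ⊆ M.E ∧ M.eRk X = (1 : ℕ)}.ncard ≤ M.E.ncard.choose 1 * 2 ^ (1 - 1) :=
      S2.ncard_eRk_eq_le_choose_mul_two_pow M 1 1
        (fun X hX hr => by
          have := ncard_add_one_le_two_pow_of_eRk_le M hL0 hfree 1 X hX hr
          omega)
    have h0 : {X : Set α | X ⊆ M.E ∧ M.eRk X = (0 : ℕ)}.ncard ≤ M.E.ncard.choose 0 * 2 ^ (0 - 0) :=
      S2.ncard_eRk_eq_le_choose_mul_two_pow M 0 0
        (fun X hX hr => by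
          have := ncard_add_one_le_two_pow_of_eRk_le M hL0 hfree 0 X hX hr
          omega)
    simp only [Nat.choose_one_right, Nat.choose_zero_right, Nat.sub_self, pow_zero, mul_one] at h1 h0
    rw [hn] at h7 h6 h5 h4 h3 h2 h1
    push_cast at hsum7 h7 h6 h5 h4 h3 h2 h1 h0
    have hA : {X : Set α | X ⊆ M.E ∧ M.eRk X ≤ 7}.ncard ≤
        (p + d).choose 7 * 2 ^ (min 72 d) + (p + d).choose 6 * 2 ^ (min 33 d) + (p + d).choose 5 * 2 ^ (min 14 d) +
          (p + d).choose 4 * 2 ^ 6 + (p + d).choose 3 * 2 ^ 3 + (p + d).choose 2 * 2 + (p + d) + 1 := by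
      omega
    have hG : {X : Set α | X ⊆ M.E ∧ M.eRk X ≤ 7}.ncard + {X : Set α | X ⊆ M.E ∧ M.eRk X = M.eRank}.ncard ≤
        (p + d).choose 7 * 2 ^ (min 72 d) + (p + d).choose 6 * 2 ^ (min 33 d) + (p + d).choose 5 * 2 ^ (min 14 d) +
          (p + d).choose 4 * 2 ^ 6 + (p + d).choose 3 * 2 ^ 3 + (p + d).choose 2 * 2 + (p + d) + 1 +
          ∑ j ∈ Finset.range (d + 1), (p + d).choose j := by
      omega
    exact le_trans (Nat.mul_le_mul_left _ hG) hT
  -- (Φ) and the polynomial inequality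
  have hΦ := phiK_le_two_pow_div p 7
  rw [Nat.choose_symm_add] at hΦ
  -- assemble in `ℚ`
  rw [RLS_iff]
  have hYq : (2 : ℚ) ^ (p + d) ≤ (Matroid.midCount M p 7 : ℚ) +
      ({X : Set α | X ⊆ M.E ∧ M.eRk X ≤ 7}.ncard : ℚ) +
      ({X : Set α | X ⊆ M.E ∧ M.eRk X = M.eRank}.ncard : ℚ) := by exact_mod_cast hY
  have hABq : (c₁ : ℚ) * (({X : Set α | X ⊆ M.E ∧ M.eRk X ≤ 7}.ncard : ℚ) +
      ({X : Set α | X ⊆ M.E ∧ M.eRk X = M.eRank}.ncard : ℚ)) ≤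
      ((c₁ - c₂ : ℕ) : ℚ) * 2 ^ (p + d) := by exact_mod_cast hAB
  have hU0' : (0 : ℚ) ≤ (Matroid.topCount M p 7 : ℚ) := Nat.cast_nonneg _
  have hd7 : 7 ≤ d := by omega
  have hc1q : (0 : ℚ) ≤ (c₁ : ℚ) := Nat.cast_nonneg _
  -- THE MAIN INEQUALITY `c₁·#U ≤ c₂·2^{d−7}·C(p+7, 7)`, by the form's disjunct and the nullity split
  have hmain : (c₁ : ℚ) * (Matroid.topCount M p 7 : ℚ) ≤ (c₂ : ℚ) * 2 ^ (d - 7) * (((p + 7).choose 7 : ℕ) : ℚ) := by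
    rcases hpolyq with hold | hsplit
    · exact (mul_le_mul_of_nonneg_left hUq hc1q).trans hold
    · by_cases hB : ∃ X ⊆ M.E, M.eRk X ≤ 7 ∧ M.eRk X + d ≤ (X.ncard : ℕ∞)
      · -- case B: a set of rank `≤ 7` carries the whole nullity
        obtain ⟨X, hX, hXr, hfull⟩ := hB
        have htop : Matroid.topCount M p 7 ≤ 2 ^ X.ncard :=
          topCount_le_two_pow_of_full M (by omega) hR hd hX hfull
        have hXc : X.ncard ≤ 7 + d := hcap X hX 7 hXr
        have h1 : (Matroid.topCount M p 7 : ℚ) ≤ 2 ^ (7 + d) := by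
          have : (2 : ℚ) ^ X.ncard ≤ 2 ^ (7 + d) := pow_le_pow_right₀ (by norm_num) hXc
          exact (by exact_mod_cast htop : (Matroid.topCount M p 7 : ℚ) ≤ (2 : ℚ) ^ X.ncard).trans this
        have h2 : (Matroid.topCount M p 7 : ℚ) ≤ nsideTel2 p d S3 S4 S5 + 2 ^ (7 + d) := by
          linarith [nsideTel2_nonneg p d S3 S4 S5]
        exact (mul_le_mul_of_nonneg_left h2 hc1q).trans hsplit
      · -- case A: every set of rank `≤ 7` has `≤ r + d − 1` points — the count with the caps one smaller
        have hB' : ∀ X ⊆ M.E, M.eRk X ≤ 7 → (X.ncard : ℕ∞) < M.eRk X + d :=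
          fun X hX hr => lt_of_not_ge (fun h => hB ⟨X, hX, hr, h⟩)
        have hflatA : ∀ X ⊆ M.E, M.eRk X ≤ 7 → X.ncard ≤ min 79 (6 + d) := by
          intro X hX hr
          refine le_min (hflat X hX hr |>.trans (min_le_left _ _)) ?_
          have hlt := hB' X hX hr
          have hXfin : X.Finite := M.ground_finite.subset hX
          have hne : M.eRk X ≠ ⊤ := ((M.eRk_le_encard _).trans_lt hXfin.encard_lt_top).ne
          obtain ⟨r, hr'⟩ := ENat.ne_top_iff_exists.1 hne
          rw [← hr'] at hlt hr
          have e1 : X.ncard < r + d := by exact_mod_cast hlt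
          have e2 : r ≤ 7 := by exact_mod_cast hr
          omega
        have hflat'A : ∀ X ⊆ M.E, M.eRk X ≤ ((7 - 1 : ℕ) : ℕ∞) → X.ncard ≤ min 39 (5 + d) := by
          intro X hX hr
          refine le_min (hflat' X hX hr |>.trans (min_le_left _ _)) ?_
          have hr7 : M.eRk X ≤ 7 := hr.trans (by norm_num)
          have hlt := hB' X hX hr7
          have hXfin : X.Finite := M.ground_finite.subset hX
          have hne : M.eRk X ≠ ⊤ := ((M.eRk_le_encard _).trans_lt hXfin.encard_lt_top).ne
          obtain ⟨r, hr'⟩ := ENat.ne_top_iff_exists.1 hne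
          rw [← hr'] at hlt hr
          have e1 : X.ncard < r + d := by exact_mod_cast hlt
          have e2 : r ≤ 6 := by exact_mod_cast hr
          omega
        have hU0A := S2.ncard_eRk_eq_ncard_le_le_tel M 7 (min 79 (6 + d)) (min 39 (5 + d))
          (max ((d + min 33 d) / 2 + 1) (min 32 (d - 1) + 2)) (min 33 d) (fun ν => ν + S2.rminF ν)
          (by norm_num) hcirc hC1 hC2 hflatA hflat'A hinter hd (by omega) (by omega) hρ hcol
        have hm1A : min (min 79 (6 + d) - (7 + 1)) (max ((d + min 33 d) / 2 + 1) (min 32 (d - 1) + 2) - 2) =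
            min (min 79 (6 + d) - 8) (max ((d + min 33 d) / 2 + 1) (min 32 (d - 1) + 2) - 2) := rfl
        have hm3A : min (min 79 (6 + d)) (7 + d) = min 79 (6 + d) := by omega
        rw [hn, sum_Icc_three_eight_q, hm1A, hm3A] at hU0A
        simp only [show (7 : ℕ) + 1 = 8 from rfl, show (8 : ℕ) - 3 = 5 from rfl, show (8 : ℕ) - 4 = 4 from rfl,
          show (8 : ℕ) - 5 = 3 from rfl, show (8 : ℕ) - 6 = 2 from rfl, show (8 : ℕ) - 7 = 1 from rfl,
          show (8 : ℕ) - 8 = 0 from rfl, Nat.choose_one_right, Nat.choose_zero_right] at hU0A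
        have hUq2 : (Matroid.topCount M p 7 : ℚ) ≤ nsideTel2 p d S3 S4 S5 := by
          have hU1q : (Matroid.topCount M p 7 : ℚ) ≤
              ({B : Set α | B ⊆ M.E ∧ M.eRk B = 7 ∧ B.ncard ≤ d}.ncard : ℚ) := by exact_mod_cast hU1
          have hsm : {C | M.IsCircuit C ∧ C.ncard = 3}.ncard * (p + d - 3).choose 5 +
              {C | M.IsCircuit C ∧ C.ncard = 4}.ncard * (p + d - 4).choose 4 +
              {C | M.IsCircuit C ∧ C.ncard = 5}.ncard * (p + d - 5).choose 3 +
              {C | M.IsCircuit C ∧ C.ncard = 6}.ncard * (p + d - 6).choose 2 +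
              {C | M.IsCircuit C ∧ C.ncard = 7}.ncard * (p + d - 7) + {C | M.IsCircuit C ∧ C.ncard = 8}.ncard * 1 ≤
              S3 * (p + d - 3).choose 5 + S4 * (p + d - 4).choose 4 +
                S5 * (p + d - 5).choose 3 + (d + 5).choose 6 * (p + d - 6).choose 2 +
                (d + 6).choose 7 * (p + d - 7) + (d + 7).choose 8 := by
            have := hs8
            gcongr
            omega
          have hsmq : (({C | M.IsCircuit C ∧ C.ncard = 3}.ncard : ℚ) * ((p + d - 3).choose 5 : ℚ) +
              ({C | M.IsCircuit C ∧ C.ncard = 4}.ncard : ℚ) * ((p + d - 4).choose 4 : ℚ) +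
              ({C | M.IsCircuit C ∧ C.ncard = 5}.ncard : ℚ) * ((p + d - 5).choose 3 : ℚ) +
              ({C | M.IsCircuit C ∧ C.ncard = 6}.ncard : ℚ) * ((p + d - 6).choose 2 : ℚ) +
              ({C | M.IsCircuit C ∧ C.ncard = 7}.ncard : ℚ) * ((p + d - 7 : ℕ) : ℚ) +
              ({C | M.IsCircuit C ∧ C.ncard = 8}.ncard : ℚ) * ((1 : ℕ) : ℚ)) ≤
              ((S3 * (p + d - 3).choose 5 + S4 * (p + d - 4).choose 4 +
                S5 * (p + d - 5).choose 3 + (d + 5).choose 6 * (p + d - 6).choose 2 +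
                (d + 6).choose 7 * (p + d - 7) + (d + 7).choose 8 : ℕ) : ℚ) := by exact_mod_cast hsm
          refine hU1q.trans (hU0A.trans ?_)
          unfold nsideTel2
          refine add_le_add (add_le_add le_rfl (Finset.sum_le_sum (fun j _ => ?_))) le_rfl
          apply S2.lamTel_mono
          push_cast at hsmq ⊢
          linarith
        have h2 : (Matroid.topCount M p 7 : ℚ) ≤ nsideTel2 p d S3 S4 S5 + 2 ^ (7 + d) := by
          linarith [show (0 : ℚ) ≤ 2 ^ (7 + d) by positivity]
        exact (mul_le_mul_of_nonneg_left h2 hc1q).trans hsplit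
  have hUq' : (Matroid.topCount M p 7 : ℚ) ≤ (((p + d).choose 7 : ℕ) : ℚ) +
      ((Matroid.topCount M p 7 : ℚ) - (((p + d).choose 7 : ℕ) : ℚ)) := by linarith
  have hpolyq' : (c₁ : ℚ) * ((((p + d).choose 7 : ℕ) : ℚ) +
      ((Matroid.topCount M p 7 : ℚ) - (((p + d).choose 7 : ℕ) : ℚ))) ≤
      (c₂ : ℚ) * 2 ^ (d - 7) * (((p + 7).choose 7 : ℕ) : ℚ) := by
    have : (((p + d).choose 7 : ℕ) : ℚ) + ((Matroid.topCount M p 7 : ℚ) - (((p + d).choose 7 : ℕ) : ℚ)) =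
        (Matroid.topCount M p 7 : ℚ) := by ring
    rw [this]; exact hmain
  exact level_arith_form (p := p) (d := d) (n := p + d) (q := 7) rfl hd7 hc₂ hc₁₂ hΦ hU0' hUq' hYq hABq hpolyq'

end ThmN

end PercRepro
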